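import Mathlib
import Literature.Analysis.Calculus.TwoVariablePartials
import Summits.FinalStateConjecture.FinalStateConjecture.Theorems.PhotonSphereChannelsUniformPhotonSphereChannelsRKernelOneGreen

/-!
# Kernel-one far channels, II: energy and momentum identities on half-characteristic trapezoids

Helper file for `stub_kernelOneChannels` of line `crum-peeling-recessive-tower` (crux
`UniformPhotonSphereChannelsR`, stmt-FinalStateConjecture-14074).  For a `C²` function `ψ` (time
first, curried) solving `ψ_tt − ψ_xx + V(x)ψ = 0` on a half-plane `{x ≥ x₀}` (equation written with
`iteratedDeriv 2` in each variable, as in the Regge–Wheeler channel items), with energy density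
`e = ψ_t² + ψ_x² + Vψ²`, momentum density `m = 2ψ_tψ_x` and sideways energy `ẽ = ψ_x² + ψ_t² − Vψ²`
(`∂_t e = ∂_x m`, `∂_x ẽ − ∂_t m = −V'ψ²`):

* `vtrap_energy_identity` — on `{s ≤ τ ≤ t, A ≤ x ≤ b − τ}` (`x₀ ≤ A`):
  `E_{[A,b−t]}(t) − E_{[A,b−s]}(s) + ∫_{b−t}^{b−s} [(ψ_t−ψ_x)² + Vψ²](b−x,x) dx = −∫_s^t m(τ,A) dτ`;
* `vtrap_momentum_identity` — same region, `V ∈ C¹`: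
  `∫_s^t ẽ(τ,A) dτ = −∫_A^{b−t} m(t,·) + ∫_{b−t}^{b−s} [(ψ_t−ψ_x)² − Vψ²](b−x,x) dx + ∫_A^{b−s} m(s,·) + ∫_s^t∫_A^{b−τ} V'ψ²`;
* `ctrap_momentum_identity` — on `{s ≤ τ ≤ t, a + τ ≤ x ≤ B}` (`x₀ ≤ a + s`):
  `∫_s^t ẽ(τ,B) dτ = ∫_{a+t}^{B} m(t,·) + ∫_{a+s}^{a+t} [(ψ_t+ψ_x)² − Vψ²](x−a,x) dx − ∫_{a+s}^{B} m(s,·) − ∫_s^t∫_{a+τ}^{B} V'ψ²`.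

All three are `vtrap_green` / `ctrap_green` applied to `(e, −m)` and `(−m, ẽ)`.
-/

noncomputable section

-- the doubled `FinalStateConjecture.FinalStateConjecture` path component trips dupNamespace
set_option linter.dupNamespace false

namespace Summit.FinalStateConjecture.FinalStateConjecture.Theorems.CrumPeelingRecessiveTower

open MeasureTheory Set Filter Topology intervalIntegral Literature.Analysis.Calculus

variable {V : ℝ → ℝ} {ψ : ℝ → ℝ → ℝ}

/-- **Energy identity on a vertical-left trapezoid.** For a `C²` function `ψ` solving
`ψ_tt − ψ_xx + V(x)ψ = 0` for `x ≥ x₀` (`V` continuous), `s ≤ t`, `x₀ ≤ A ≤ b − t`: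
the energy on the top `[A, b−t] × {t}` minus the energy on the base `[A, b−s] × {s}` plus the
(signed-definite for `V ≥ 0`) out-flux through the incoming characteristic side `x = b − τ` equals
the momentum flux `−∫_s^t 2ψ_tψ_x(τ, A) dτ` through the vertical side. -/
theorem vtrap_energy_identity (hV : Continuous V) (hψ : ContDiff ℝ 2 (Function.uncurry ψ))
    {x₀ : ℝ} (hsol : ∀ τ x, x₀ ≤ x →
      iteratedDeriv 2 (fun σ => ψ σ x) τ - iteratedDeriv 2 (ψ τ) x + V x * ψ τ x = 0)
    {A b s t : ℝ} (hst : s ≤ t) (hAb : A ≤ b - t) (hA : x₀ ≤ A) :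
    (∫ x in A..(b - t), (deriv (fun τ => ψ τ x) t ^ 2 + deriv (ψ t) x ^ 2 + V x * ψ t x ^ 2))
      - (∫ x in A..(b - s), (deriv (fun τ => ψ τ x) s ^ 2 + deriv (ψ s) x ^ 2 + V x * ψ s x ^ 2))
      + (∫ x in (b - t)..(b - s), ((deriv (fun τ => ψ τ x) (b - x) - deriv (ψ (b - x)) x) ^ 2
          + V x * ψ (b - x) x ^ 2))
    = -∫ τ in s..t, 2 * (deriv (fun σ => ψ σ A) τ * deriv (ψ τ) A) := by
  obtain ⟨ψt, ψx, ψtt, ψtx, ψxx, hct, hcx, hctt, hctx, hcxx, h1, h2, h3, h4, h5, h6, h7, h8⟩ :=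
    exists_partials_of_contDiff_two hψ
  have heq : ∀ τ x, x₀ ≤ x → ψtt τ x = ψxx τ x - V x * ψ τ x := by
    intro τ x hx; have := hsol τ x hx; rw [h7, h8] at this; linarith
  have hd1 : ∀ t x, deriv (fun τ => ψ τ x) t = ψt t x := fun t x => (h1 t x).deriv
  have hd2 : ∀ t x, deriv (ψ t) x = ψx t x := fun t x => (h2 t x).deriv
  simp only [hd1, hd2]
  -- `f = e`, `g = -m`
  set e : ℝ → ℝ → ℝ := fun τ x => ψt τ x ^ 2 + ψx τ x ^ 2 + V x * ψ τ x ^ 2 with he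
  set eτ : ℝ → ℝ → ℝ := fun τ x =>
    2 * (ψt τ x * ψtt τ x) + 2 * (ψx τ x * ψtx τ x) + 2 * (V x * (ψ τ x * ψt τ x)) with heτ
  set g : ℝ → ℝ → ℝ := fun τ x => -(2 * (ψt τ x * ψx τ x)) with hg
  set gx : ℝ → ℝ → ℝ := fun τ x => -(2 * (ψtx τ x * ψx τ x + ψt τ x * ψxx τ x)) with hgx
  have ha : Continuous fun p : ℝ × ℝ => ψt p.1 p.2 := hct
  have hb : Continuous fun p : ℝ × ℝ => ψx p.1 p.2 := hcx
  have hc : Continuous fun p : ℝ × ℝ => ψ p.1 p.2 := hψ.continuous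
  have hd : Continuous fun p : ℝ × ℝ => V p.2 := hV.comp continuous_snd
  have ha' : Continuous fun p : ℝ × ℝ => ψtt p.1 p.2 := hctt
  have hb' : Continuous fun p : ℝ × ℝ => ψtx p.1 p.2 := hctx
  have hc' : Continuous fun p : ℝ × ℝ => ψxx p.1 p.2 := hcxx
  have he_c : Continuous (Function.uncurry e) := by
    show Continuous fun p : ℝ × ℝ => ψt p.1 p.2 ^ 2 + ψx p.1 p.2 ^ 2 + V p.2 * ψ p.1 p.2 ^ 2
    fun_prop
  have heτ_c : Continuous (Function.uncurry eτ) := by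
    show Continuous fun p : ℝ × ℝ => 2 * (ψt p.1 p.2 * ψtt p.1 p.2)
      + 2 * (ψx p.1 p.2 * ψtx p.1 p.2) + 2 * (V p.2 * (ψ p.1 p.2 * ψt p.1 p.2))
    fun_prop
  have hg_c : Continuous (Function.uncurry g) := by
    show Continuous fun p : ℝ × ℝ => -(2 * (ψt p.1 p.2 * ψx p.1 p.2))
    fun_prop
  have hgx_c : Continuous (Function.uncurry gx) := by
    show Continuous fun p : ℝ × ℝ => -(2 * (ψtx p.1 p.2 * ψx p.1 p.2 + ψt p.1 p.2 * ψxx p.1 p.2))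
    fun_prop
  have hde : ∀ τ x, HasDerivAt (fun σ => e σ x) (eτ τ x) τ := by
    intro τ x
    refine ((((h3 τ x).pow 2).add ((h4 τ x).pow 2)).add
      (((h1 τ x).pow 2).const_mul (V x))).congr_deriv ?_
    simp only [heτ]
    push_cast
    ring
  have hdg : ∀ τ x, HasDerivAt (g τ) (gx τ x) x := by
    intro τ x
    exact (((h5 τ x).mul (h6 τ x)).const_mul 2).neg
  have hG := vtrap_green he_c hg_c heτ_c hgx_c hde hdg hst hAb
  -- the divergence vanishes on the region
  have hzero : (∫ τ in s..t, ∫ x in A..(b - τ), (eτ τ x + gx τ x)) = 0 := by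
    rw [← intervalIntegral.integral_zero (a := s) (b := t)]
    refine integral_congr fun τ hτ => ?_
    rw [uIcc_of_le hst] at hτ
    have hle : A ≤ b - τ := by linarith [hτ.2]
    rw [← intervalIntegral.integral_zero (a := A) (b := b - τ)]
    refine integral_congr fun x hx => ?_
    rw [uIcc_of_le hle] at hx
    simp only [heτ, hgx, heq τ x (hA.trans hx.1)]
    ring
  rw [hzero] at hG
  -- the characteristic flux, reparametrised
  have hflux : (∫ τ in s..t, g τ (b - τ)) = ∫ x in (b - t)..(b - s), g (b - x) x := by
    rw [← integral_comp_sub_left (fun x => g (b - x) x) b]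
    simp
  rw [hflux] at hG
  have hgl : (∫ τ in s..t, g τ A) = -∫ τ in s..t, 2 * (ψt τ A * ψx τ A) := by
    rw [← intervalIntegral.integral_neg]
  rw [hgl] at hG
  -- the out-flux integrand is `e + g`
  have hcomb : (∫ x in (b - t)..(b - s), ((ψt (b - x) x - ψx (b - x) x) ^ 2
      + V x * ψ (b - x) x ^ 2))
      = (∫ x in (b - t)..(b - s), e (b - x) x) + ∫ x in (b - t)..(b - s), g (b - x) x := by
    have c1 : Continuous fun x => e (b - x) x :=
      he_c.comp ((continuous_const.sub continuous_id).prodMk continuous_id)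
    have c2 : Continuous fun x => g (b - x) x :=
      hg_c.comp ((continuous_const.sub continuous_id).prodMk continuous_id)
    rw [← intervalIntegral.integral_add (c1.intervalIntegrable _ _) (c2.intervalIntegrable _ _)]
    refine integral_congr fun x _ => ?_
    simp only [he, hg]
    ring
  rw [hcomb]
  simp only [he] at hG ⊢
  linarith

/-- **Momentum (sideways-energy) identity on a vertical-left trapezoid.** For `V ∈ C¹`, a `C²`
function `ψ` solving `ψ_tt − ψ_xx + V(x)ψ = 0` for `x ≥ x₀`, `s ≤ t`, `x₀ ≤ A ≤ b − t`, with
`ẽ = ψ_x² + ψ_t² − Vψ²` and `m = 2ψ_tψ_x`: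
`∫_s^t ẽ(τ, A) dτ = −∫_A^{b−t} m(t,·) + ∫_{b−t}^{b−s} [(ψ_t−ψ_x)² − Vψ²](b−x, x) dx + ∫_A^{b−s} m(s,·) + ∫_s^t ∫_A^{b−τ} V'(x) ψ(τ,x)² dx dτ`. -/
theorem vtrap_momentum_identity (hV : ContDiff ℝ 1 V) (hψ : ContDiff ℝ 2 (Function.uncurry ψ))
    {x₀ : ℝ} (hsol : ∀ τ x, x₀ ≤ x →
      iteratedDeriv 2 (fun σ => ψ σ x) τ - iteratedDeriv 2 (ψ τ) x + V x * ψ τ x = 0)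
    {A b s t : ℝ} (hst : s ≤ t) (hAb : A ≤ b - t) (hA : x₀ ≤ A) :
    (∫ τ in s..t, (deriv (ψ τ) A ^ 2 + deriv (fun σ => ψ σ A) τ ^ 2 - V A * ψ τ A ^ 2))
    = -(∫ x in A..(b - t), 2 * (deriv (fun σ => ψ σ x) t * deriv (ψ t) x))
      + (∫ x in (b - t)..(b - s), ((deriv (fun τ => ψ τ x) (b - x) - deriv (ψ (b - x)) x) ^ 2
          - V x * ψ (b - x) x ^ 2))
      + (∫ x in A..(b - s), 2 * (deriv (fun σ => ψ σ x) s * deriv (ψ s) x))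
      + ∫ τ in s..t, ∫ x in A..(b - τ), deriv V x * ψ τ x ^ 2 := by
  obtain ⟨ψt, ψx, ψtt, ψtx, ψxx, hct, hcx, hctt, hctx, hcxx, h1, h2, h3, h4, h5, h6, h7, h8⟩ :=
    exists_partials_of_contDiff_two hψ
  have heq : ∀ τ x, x₀ ≤ x → ψtt τ x = ψxx τ x - V x * ψ τ x := by
    intro τ x hx; have := hsol τ x hx; rw [h7, h8] at this; linarith
  have hd1 : ∀ t x, deriv (fun τ => ψ τ x) t = ψt t x := fun t x => (h1 t x).deriv
  have hd2 : ∀ t x, deriv (ψ t) x = ψx t x := fun t x => (h2 t x).deriv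
  have hVd : ∀ x, HasDerivAt V (deriv V x) x := fun x =>
    ((hV.differentiable (by norm_num)) x).hasDerivAt
  have hV'c : Continuous (deriv V) := hV.continuous_deriv le_rfl
  simp only [hd1, hd2]
  -- `f = -m`, `g = ẽ`
  set f : ℝ → ℝ → ℝ := fun τ x => -(2 * (ψt τ x * ψx τ x)) with hf
  set fτ : ℝ → ℝ → ℝ := fun τ x => -(2 * (ψtt τ x * ψx τ x + ψt τ x * ψtx τ x)) with hfτ
  set g : ℝ → ℝ → ℝ := fun τ x => ψx τ x ^ 2 + ψt τ x ^ 2 - V x * ψ τ x ^ 2 with hg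
  set gx : ℝ → ℝ → ℝ := fun τ x => 2 * (ψx τ x * ψxx τ x) + 2 * (ψt τ x * ψtx τ x)
    - (deriv V x * ψ τ x ^ 2 + V x * (2 * (ψ τ x * ψx τ x))) with hgx
  have ha : Continuous fun p : ℝ × ℝ => ψt p.1 p.2 := hct
  have hb : Continuous fun p : ℝ × ℝ => ψx p.1 p.2 := hcx
  have hc : Continuous fun p : ℝ × ℝ => ψ p.1 p.2 := hψ.continuous
  have hd : Continuous fun p : ℝ × ℝ => V p.2 := hV.continuous.comp continuous_snd
  have hd' : Continuous fun p : ℝ × ℝ => deriv V p.2 := hV'c.comp continuous_snd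
  have ha' : Continuous fun p : ℝ × ℝ => ψtt p.1 p.2 := hctt
  have hb' : Continuous fun p : ℝ × ℝ => ψtx p.1 p.2 := hctx
  have hc' : Continuous fun p : ℝ × ℝ => ψxx p.1 p.2 := hcxx
  have hf_c : Continuous (Function.uncurry f) := by
    show Continuous fun p : ℝ × ℝ => -(2 * (ψt p.1 p.2 * ψx p.1 p.2))
    fun_prop
  have hfτ_c : Continuous (Function.uncurry fτ) := by
    show Continuous fun p : ℝ × ℝ => -(2 * (ψtt p.1 p.2 * ψx p.1 p.2 + ψt p.1 p.2 * ψtx p.1 p.2))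
    fun_prop
  have hg_c : Continuous (Function.uncurry g) := by
    show Continuous fun p : ℝ × ℝ => ψx p.1 p.2 ^ 2 + ψt p.1 p.2 ^ 2 - V p.2 * ψ p.1 p.2 ^ 2
    fun_prop
  have hgx_c : Continuous (Function.uncurry gx) := by
    show Continuous fun p : ℝ × ℝ => 2 * (ψx p.1 p.2 * ψxx p.1 p.2) + 2 * (ψt p.1 p.2 * ψtx p.1 p.2)
      - (deriv V p.2 * ψ p.1 p.2 ^ 2 + V p.2 * (2 * (ψ p.1 p.2 * ψx p.1 p.2)))
    fun_prop
  have hdf : ∀ τ x, HasDerivAt (fun σ => f σ x) (fτ τ x) τ := by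
    intro τ x
    refine (((h3 τ x).mul (h4 τ x)).const_mul 2).neg.congr_deriv ?_
    simp only [hfτ]
  have hdg : ∀ τ x, HasDerivAt (g τ) (gx τ x) x := by
    intro τ x
    refine ((((h6 τ x).pow 2).add ((h5 τ x).pow 2)).sub
      ((hVd x).mul ((h2 τ x).pow 2))).congr_deriv ?_
    simp only [hgx, Pi.pow_apply]
    push_cast
    ring
  have hG := vtrap_green hf_c hg_c hfτ_c hgx_c hdf hdg hst hAb
  -- the divergence is `-V'ψ²` on the region
  have hbulk : (∫ τ in s..t, ∫ x in A..(b - τ), (fτ τ x + gx τ x))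
      = -∫ τ in s..t, ∫ x in A..(b - τ), deriv V x * ψ τ x ^ 2 := by
    rw [← intervalIntegral.integral_neg]
    refine integral_congr fun τ hτ => ?_
    rw [uIcc_of_le hst] at hτ
    have hle : A ≤ b - τ := by linarith [hτ.2]
    rw [← intervalIntegral.integral_neg]
    refine integral_congr fun x hx => ?_
    rw [uIcc_of_le hle] at hx
    simp only [hfτ, hgx, heq τ x (hA.trans hx.1)]
    ring
  rw [hbulk] at hG
  -- the characteristic flux, reparametrised
  have hflux : (∫ τ in s..t, g τ (b - τ)) = ∫ x in (b - t)..(b - s), g (b - x) x := by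
    rw [← integral_comp_sub_left (fun x => g (b - x) x) b]
    simp
  rw [hflux] at hG
  have hcomb : (∫ x in (b - t)..(b - s), ((ψt (b - x) x - ψx (b - x) x) ^ 2
      - V x * ψ (b - x) x ^ 2))
      = (∫ x in (b - t)..(b - s), g (b - x) x) + ∫ x in (b - t)..(b - s), f (b - x) x := by
    have c1 : Continuous fun x => g (b - x) x :=
      hg_c.comp ((continuous_const.sub continuous_id).prodMk continuous_id)
    have c2 : Continuous fun x => f (b - x) x :=
      hf_c.comp ((continuous_const.sub continuous_id).prodMk continuous_id)
    rw [← intervalIntegral.integral_add (c1.intervalIntegrable _ _) (c2.intervalIntegrable _ _)]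
    refine integral_congr fun x _ => ?_
    simp only [hf, hg]
    ring
  have htop : (∫ x in A..(b - t), f t x) = -∫ x in A..(b - t), 2 * (ψt t x * ψx t x) := by
    rw [← intervalIntegral.integral_neg]
  have hbase : (∫ x in A..(b - s), f s x) = -∫ x in A..(b - s), 2 * (ψt s x * ψx s x) := by
    rw [← intervalIntegral.integral_neg]
  rw [hcomb]
  rw [htop, hbase] at hG
  simp only [hg] at hG ⊢
  linarith

/-- **Momentum (sideways-energy) identity on a vertical-right trapezoid.** For `V ∈ C¹`, a `C²`
function `ψ` solving `ψ_tt − ψ_xx + V(x)ψ = 0` for `x ≥ x₀`, `s ≤ t`, `a + t ≤ B`, `x₀ ≤ a + s`: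
`∫_s^t ẽ(τ, B) dτ = ∫_{a+t}^{B} m(t,·) + ∫_{a+s}^{a+t} [(ψ_t+ψ_x)² − Vψ²](x−a, x) dx − ∫_{a+s}^{B} m(s,·) − ∫_s^t ∫_{a+τ}^{B} V'(x) ψ(τ,x)² dx dτ`. -/
theorem ctrap_momentum_identity (hV : ContDiff ℝ 1 V) (hψ : ContDiff ℝ 2 (Function.uncurry ψ))
    {x₀ : ℝ} (hsol : ∀ τ x, x₀ ≤ x →
      iteratedDeriv 2 (fun σ => ψ σ x) τ - iteratedDeriv 2 (ψ τ) x + V x * ψ τ x = 0)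
    {a B s t : ℝ} (hst : s ≤ t) (haB : a + t ≤ B) (ha0 : x₀ ≤ a + s) :
    (∫ τ in s..t, (deriv (ψ τ) B ^ 2 + deriv (fun σ => ψ σ B) τ ^ 2 - V B * ψ τ B ^ 2))
    = (∫ x in (a + t)..B, 2 * (deriv (fun σ => ψ σ x) t * deriv (ψ t) x))
      + (∫ x in (a + s)..(a + t), ((deriv (fun τ => ψ τ x) (x - a) + deriv (ψ (x - a)) x) ^ 2
          - V x * ψ (x - a) x ^ 2))
      - (∫ x in (a + s)..B, 2 * (deriv (fun σ => ψ σ x) s * deriv (ψ s) x))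
      - ∫ τ in s..t, ∫ x in (a + τ)..B, deriv V x * ψ τ x ^ 2 := by
  obtain ⟨ψt, ψx, ψtt, ψtx, ψxx, hct, hcx, hctt, hctx, hcxx, h1, h2, h3, h4, h5, h6, h7, h8⟩ :=
    exists_partials_of_contDiff_two hψ
  have heq : ∀ τ x, x₀ ≤ x → ψtt τ x = ψxx τ x - V x * ψ τ x := by
    intro τ x hx; have := hsol τ x hx; rw [h7, h8] at this; linarith
  have hd1 : ∀ t x, deriv (fun τ => ψ τ x) t = ψt t x := fun t x => (h1 t x).deriv
  have hd2 : ∀ t x, deriv (ψ t) x = ψx t x := fun t x => (h2 t x).deriv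
  have hVd : ∀ x, HasDerivAt V (deriv V x) x := fun x =>
    ((hV.differentiable (by norm_num)) x).hasDerivAt
  have hV'c : Continuous (deriv V) := hV.continuous_deriv le_rfl
  simp only [hd1, hd2]
  set f : ℝ → ℝ → ℝ := fun τ x => -(2 * (ψt τ x * ψx τ x)) with hf
  set fτ : ℝ → ℝ → ℝ := fun τ x => -(2 * (ψtt τ x * ψx τ x + ψt τ x * ψtx τ x)) with hfτ
  set g : ℝ → ℝ → ℝ := fun τ x => ψx τ x ^ 2 + ψt τ x ^ 2 - V x * ψ τ x ^ 2 with hg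
  set gx : ℝ → ℝ → ℝ := fun τ x => 2 * (ψx τ x * ψxx τ x) + 2 * (ψt τ x * ψtx τ x)
    - (deriv V x * ψ τ x ^ 2 + V x * (2 * (ψ τ x * ψx τ x))) with hgx
  have ha : Continuous fun p : ℝ × ℝ => ψt p.1 p.2 := hct
  have hb : Continuous fun p : ℝ × ℝ => ψx p.1 p.2 := hcx
  have hc : Continuous fun p : ℝ × ℝ => ψ p.1 p.2 := hψ.continuous
  have hd : Continuous fun p : ℝ × ℝ => V p.2 := hV.continuous.comp continuous_snd
  have hd' : Continuous fun p : ℝ × ℝ => deriv V p.2 := hV'c.comp continuous_snd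
  have ha' : Continuous fun p : ℝ × ℝ => ψtt p.1 p.2 := hctt
  have hb' : Continuous fun p : ℝ × ℝ => ψtx p.1 p.2 := hctx
  have hc' : Continuous fun p : ℝ × ℝ => ψxx p.1 p.2 := hcxx
  have hf_c : Continuous (Function.uncurry f) := by
    show Continuous fun p : ℝ × ℝ => -(2 * (ψt p.1 p.2 * ψx p.1 p.2))
    fun_prop
  have hfτ_c : Continuous (Function.uncurry fτ) := by
    show Continuous fun p : ℝ × ℝ => -(2 * (ψtt p.1 p.2 * ψx p.1 p.2 + ψt p.1 p.2 * ψtx p.1 p.2))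
    fun_prop
  have hg_c : Continuous (Function.uncurry g) := by
    show Continuous fun p : ℝ × ℝ => ψx p.1 p.2 ^ 2 + ψt p.1 p.2 ^ 2 - V p.2 * ψ p.1 p.2 ^ 2
    fun_prop
  have hgx_c : Continuous (Function.uncurry gx) := by
    show Continuous fun p : ℝ × ℝ => 2 * (ψx p.1 p.2 * ψxx p.1 p.2) + 2 * (ψt p.1 p.2 * ψtx p.1 p.2)
      - (deriv V p.2 * ψ p.1 p.2 ^ 2 + V p.2 * (2 * (ψ p.1 p.2 * ψx p.1 p.2)))
    fun_prop
  have hdf : ∀ τ x, HasDerivAt (fun σ => f σ x) (fτ τ x) τ := by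
    intro τ x
    refine (((h3 τ x).mul (h4 τ x)).const_mul 2).neg.congr_deriv ?_
    simp only [hfτ]
  have hdg : ∀ τ x, HasDerivAt (g τ) (gx τ x) x := by
    intro τ x
    refine ((((h6 τ x).pow 2).add ((h5 τ x).pow 2)).sub
      ((hVd x).mul ((h2 τ x).pow 2))).congr_deriv ?_
    simp only [hgx, Pi.pow_apply]
    push_cast
    ring
  have hG := ctrap_green hf_c hg_c hfτ_c hgx_c hdf hdg hst haB
  have hbulk : (∫ τ in s..t, ∫ x in (a + τ)..B, (fτ τ x + gx τ x))
      = -∫ τ in s..t, ∫ x in (a + τ)..B, deriv V x * ψ τ x ^ 2 := by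
    rw [← intervalIntegral.integral_neg]
    refine integral_congr fun τ hτ => ?_
    rw [uIcc_of_le hst] at hτ
    have hle : a + τ ≤ B := by linarith [hτ.2]
    rw [← intervalIntegral.integral_neg]
    refine integral_congr fun x hx => ?_
    rw [uIcc_of_le hle] at hx
    have hx0 : x₀ ≤ x := by linarith [hx.1, hτ.1]
    simp only [hfτ, hgx, heq τ x hx0]
    ring
  rw [hbulk] at hG
  have hflux : (∫ τ in s..t, g τ (a + τ)) = ∫ x in (a + s)..(a + t), g (x - a) x := by
    rw [show a + s = s + a by ring, show a + t = t + a by ring,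
      ← integral_comp_add_right (fun x => g (x - a) x) a]
    simp [add_comm]
  rw [hflux] at hG
  have hcomb : (∫ x in (a + s)..(a + t), ((ψt (x - a) x + ψx (x - a) x) ^ 2
      - V x * ψ (x - a) x ^ 2))
      = (∫ x in (a + s)..(a + t), g (x - a) x) - ∫ x in (a + s)..(a + t), f (x - a) x := by
    have c1 : Continuous fun x => g (x - a) x :=
      hg_c.comp ((continuous_id.sub continuous_const).prodMk continuous_id)
    have c2 : Continuous fun x => f (x - a) x :=
      hf_c.comp ((continuous_id.sub continuous_const).prodMk continuous_id)
    rw [← intervalIntegral.integral_sub (c1.intervalIntegrable _ _) (c2.intervalIntegrable _ _)]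
    refine integral_congr fun x _ => ?_
    simp only [hf, hg]
    ring
  have htop : (∫ x in (a + t)..B, f t x) = -∫ x in (a + t)..B, 2 * (ψt t x * ψx t x) := by
    rw [← intervalIntegral.integral_neg]
  have hbase : (∫ x in (a + s)..B, f s x) = -∫ x in (a + s)..B, 2 * (ψt s x * ψx s x) := by
    rw [← intervalIntegral.integral_neg]
  rw [hcomb]
  rw [htop, hbase] at hG
  simp only [hg] at hG ⊢
  linarith

/-- Registered form of `vtrap_energy_identity` (sub-goal `stub_kernelOneIdentities` of the crux
item). -/
theorem stub_kernelOneIdentities : ∀ (V : ℝ → ℝ) (ψ : ℝ → ℝ → ℝ), Continuous V →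
    ContDiff ℝ 2 (Function.uncurry ψ) → ∀ (x₀ : ℝ), (∀ τ x, x₀ ≤ x →
      iteratedDeriv 2 (fun σ => ψ σ x) τ - iteratedDeriv 2 (ψ τ) x + V x * ψ τ x = 0) →
    ∀ (A b s t : ℝ), s ≤ t → A ≤ b - t → x₀ ≤ A →
    (∫ x in A..(b - t), (deriv (fun τ => ψ τ x) t ^ 2 + deriv (ψ t) x ^ 2 + V x * ψ t x ^ 2))
      - (∫ x in A..(b - s), (deriv (fun τ => ψ τ x) s ^ 2 + deriv (ψ s) x ^ 2 + V x * ψ s x ^ 2))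
      + (∫ x in (b - t)..(b - s), ((deriv (fun τ => ψ τ x) (b - x) - deriv (ψ (b - x)) x) ^ 2
          + V x * ψ (b - x) x ^ 2))
    = -∫ τ in s..t, 2 * (deriv (fun σ => ψ σ A) τ * deriv (ψ τ) A) :=
  fun _ _ hV hψ _ hsol _ _ _ _ hst hAb hA => vtrap_energy_identity hV hψ hsol hst hAb hA

end Summit.FinalStateConjecture.FinalStateConjecture.Theorems.CrumPeelingRecessiveTower
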